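import Summits.CriticalPhenomena.Ising3D.IsingColumnFaceL11CensusDistinctLin
import Summits.CriticalPhenomena.Ising3D.IsingColumnFaceL11CensusDistinctTrg

/-!
# The catalogue census of §7.3 as kernel facts, IX: the distinct-values machine, part 8 — across the two tables: the
sixteen common values, the union count, the resolution of the transcendental catalogue on the segment (cell
`pub-ising3x`, seat recog-1; paper §1.6 / §7.3)

HONEST FRAMING: lottery ticket; floor = tightest certified 3D Ising CFT bounds; no exact-solution
claim without a proof. Island framing: certified exclusion region at stated derivative order and
assumptions; not a determination of the 3D Ising critical exponents beyond that.

* `linIsTrg_shape` / `trgOfLinForm` / `linForm_mem_trgFullFamily` — a `TRG`-form `LIN` tuple is `(0, p·e_K, q)` and its value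
  `(p/q)·K` is a member of `trgFullFamily 17 32`;
* **`mem_inter_imp_form`** — a real number in BOTH tables and in the segment is the value of a `TRG`-form `LIN` tuple
  (any other primitive `LIN` tuple is `≥ dX/distU > 0` away from every `TRG` value, `cross_descr_separated`);
* **`lin_inter_trg_segment_eq`** / **`lin_inter_trg_segment_ncard`** — on `[81/64, 2855/2048]` the two tables share EXACTLY the
  sixteen values `ζ(5)·{11/9, 5/4, 9/7, 4/3}`, `ζ(3)·{12/11, 11/10, 10/9, 9/8, 8/7}`, `G·{7/5, 10/7, 3/2}`, `log 2·{11/6, 2}`,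
  `π·{5/12, 3/7}` (`linForms16`; which form tuples lie in the segment is decided by the census machine's `linBinOf`);
* **`realTables_values_ncard`** — `linFamily 12 ∪ trgFullFamily 17 32` has exactly `112660 + 39339 − 16 = 151983` distinct
  values in the segment; **`realTables_resolution`** — any two of them differ by at least `dL/distU = 4.3966…·10⁻¹²`: a
  certified `Δε`-interval narrower than that contains AT MOST ONE member of the two transcendental tables (the far side
  of §1.6's «no acceptance power at 10⁻² widths»: nine orders of magnitude below this paper's certified widths, six below
  the floating-point literature's).
Both tables read `log 2` at twenty digits from the landed `LogTwoBounds` (`kZT` / `linZEnclT`, `trgGEnclT`; TRG also `e` from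
Mathlib's `Real.exp_one_near_20`) — necessary: at the landed ten digits a `LIN` enclosure up to `2.4·10⁻⁹` wide contains `TRG` values;
no constant is certified anew. A statement about the catalogue, NOT about `Δε`; nothing is recognised (§1.6); no P(M·) relevance.
lottery ticket; floor = tightest certified 3D Ising CFT bounds; no exact-solution claim without a proof.
-/

namespace Summit.CriticalPhenomena.Ising3D
namespace ColumnFaceL11
open Set Literature.MathematicalPhysics.QuantumFieldTheory.ConformalBootstrap3D

/-! ### The shape of a `TRG`-form `LIN` tuple, and its `TRG` twin -/

/-- A `TRG`-form tuple of the table is `(0, 0…0 p 0…0, q)` with `1 ≤ p ≤ 12` at some index `i < 7`. [folklore] -/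
theorem linIsTrg_shape {a0 : ℤ} {c : List ℤ} {ax : ℕ} (hok : linTupleOK 12 (a0, c, ax) = true)
    (h : linIsTrg (a0, c, ax) = true) :
    a0 = 0 ∧ ∃ i p : ℕ, i < 7 ∧ 1 ≤ p ∧ p ≤ 12 ∧ c = List.replicate i 0 ++ (p : ℤ) :: List.replicate (6 - i) 0 := by
  have hok' := hok
  simp only [linTupleOK, Bool.and_eq_true, decide_eq_true_eq, List.all_eq_true] at hok'
  obtain ⟨⟨⟨⟨⟨hlen, -⟩, -⟩, hb⟩, -⟩, hne⟩ := hok'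
  simp only [linIsTrg, decide_eq_true_eq] at h
  obtain ⟨ha0, hlen1, hpos⟩ := h
  obtain ⟨i, v, rest, hsplit, hv⟩ := exists_first_ne_zero c (by rw [hlen]; exact hne)
  have hfilt : c.filter (· ≠ 0) = v :: rest.filter (· ≠ 0) := by
    rw [hsplit, filter_ne_zero_replicate_append, List.filter_cons_of_pos (by simpa using hv)]
  rw [hfilt, List.length_cons] at hlen1
  have hrest0 : ∀ y ∈ rest, y = (0 : ℤ) := by
    have h0 : rest.filter (· ≠ 0) = [] := List.eq_nil_of_length_eq_zero (by omega)
    intro y hy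
    by_contra hy0
    have := List.filter_eq_nil_iff.mp h0 y hy
    simp [hy0] at this
  have hrest : rest = List.replicate rest.length 0 := List.eq_replicate_of_mem hrest0
  have hlen' : i + 1 + rest.length = 7 := by
    have := congrArg List.length hsplit
    simp only [List.length_append, List.length_replicate, List.length_cons] at this; omega
  have hvmem : v ∈ c := by rw [hsplit]; simp
  have hvpos : 0 < v := lt_of_le_of_ne (hpos v hvmem) (Ne.symm hv)
  obtain ⟨-, hv12⟩ := hb v hvmem
  refine ⟨ha0, i, v.toNat, by omega, by omega, by omega, ?_⟩
  rw [hsplit, hrest]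
  have e1 : ((v.toNat : ℕ) : ℤ) = v := Int.toNat_of_nonneg hvpos.le
  have e2 : rest.length = 6 - i := by omega
  rw [e1, e2]

/-- The `TRG` description of the form `(0, p·e_i, q)`: `(p/q)·π, π², π³` (`a = 2, 4, 6`), `(p/q)·log 2, ζ(3), ζ(5), G`
(`s = 1`, `L = 0, 2, 3, 4`). [folklore] -/
def trgOfLinForm (i p q : ℕ) : TrgTuple :=
  match i with
  | 0 => (p, q, 0, 2, 0, 0, 0, 0)
  | 1 => (p, q, 0, 4, 0, 0, 0, 0)
  | 2 => (p, q, 0, 6, 0, 0, 0, 0)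
  | 3 => (p, q, 0, 0, 0, 0, 0, 1)
  | 4 => (p, q, 0, 0, 0, 0, 2, 1)
  | 5 => (p, q, 0, 0, 0, 0, 3, 1)
  | _ => (p, q, 0, 0, 0, 0, 4, 1)

/-- The `TRG` twin is a canonical lowest-terms tuple of the table when `1 ≤ p, q ≤ 12` are coprime. [folklore] -/
theorem trgOfLinForm_ok {i p q : ℕ} (hi : i < 7) (hp1 : 1 ≤ p) (hp : p ≤ 12) (hq1 : 1 ≤ q) (hq : q ≤ 12)
    (hg : Nat.gcd p q = 1) :
    trgGTupleOK 17 32 (trgOfLinForm i p q) = true ∧ trgCanon (trgOfLinForm i p q) = true ∧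
      trgPrim (trgOfLinForm i p q) = true := by
  interval_cases i <;>
    simp only [trgOfLinForm, trgGTupleOK, trgCanon, trgPrim, Bool.and_eq_true, decide_eq_true_eq, beq_iff_eq,
      Bool.not_eq_true', decide_eq_false_iff_not, if_true] <;> omega

/-- `(√π)^(2k) = π^k`. [folklore] -/
theorem sqrtPi_zpow_even (k : ℕ) : Real.sqrt Real.pi ^ ((2 * k : ℕ) : ℤ) = Real.pi ^ k := by
  rw [zpow_natCast, pow_mul, Real.sq_sqrt Real.pi_pos.le]

/-- The `TRG` twin has the same value. [folklore] -/
theorem trgOfLinForm_val {i p q : ℕ} (hi : i < 7) :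
    trgGTupleVal (trgOfLinForm i p q) =
      lin7TupleVal (0, List.replicate i 0 ++ (p : ℤ) :: List.replicate (6 - i) 0, q) := by
  have h2 := sqrtPi_zpow_even 1
  have h4 := sqrtPi_zpow_even 2
  have h6 := sqrtPi_zpow_even 3
  norm_num at h2 h4 h6
  interval_cases i <;>
    simp [trgOfLinForm, trgGTupleVal, trgGVal, trgLVal, uVal, l5Val, gamVal, lin7TupleVal, List.replicate,
      lin7Val_seven, h2, h4, h6] <;> ring

/-- `gcdList` of a form vector is its non-zero entry. [folklore] -/
theorem gcdList_form (i p j : ℕ) : gcdList (List.replicate i 0 ++ (p : ℤ) :: List.replicate j 0) = p := by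
  have hz : ∀ j, gcdList (List.replicate j (0 : ℤ)) = 0 := by
    intro j; induction j with
    | zero => rfl
    | succ n ih => simp [List.replicate_succ, gcdList, ih]
  induction i with
  | zero => simp [gcdList, hz]
  | succ n ih => simp [List.replicate_succ, gcdList, ih]

/-- **A `TRG`-form `LIN` value is a `TRG` value** (with a canonical lowest-terms `TRG` description). [folklore] -/
theorem linForm_mem_trgFullFamily {e : ℤ × List ℤ × ℕ} (hok : linTupleOK 12 e = true) (hprim : linPrim e = true)
    (h : linIsTrg e = true) :
    ∃ e' : TrgTuple, trgGTupleOK 17 32 e' = true ∧ trgCanon e' = true ∧ trgPrim e' = true ∧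
      trgGTupleVal e' = lin7TupleVal e := by
  obtain ⟨a0, c, ax⟩ := e
  obtain ⟨rfl, i, p, hi, hp1, hp, rfl⟩ := linIsTrg_shape hok h
  have hok' := hok
  simp only [linTupleOK, Bool.and_eq_true, decide_eq_true_eq] at hok'
  obtain ⟨⟨⟨⟨⟨-, h1⟩, h2⟩, -⟩, -⟩, -⟩ := hok'
  have hg : Nat.gcd p ax = 1 := by
    simp only [linPrim, beq_iff_eq, Int.natAbs_zero, Nat.gcd_zero_left, gcdList_form] at hprim
    rw [Nat.gcd_comm]; exact hprim
  obtain ⟨hok2, hcan2, hprim2⟩ := trgOfLinForm_ok hi hp1 hp h1 h2 hg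
  exact ⟨_, hok2, hcan2, hprim2, trgOfLinForm_val hi⟩

/-! ### The common values of the two tables on the segment -/

/-- **A common value is a `TRG`-form `LIN` value.** [folklore] -/
theorem mem_inter_imp_form {x : ℝ} (hL : x ∈ linFamily 12) (hT : x ∈ trgFullFamily 17 32)
    (h1 : (81 / 64 : ℝ) ≤ x) (h2 : x ≤ 2855 / 2048) :
    ∃ e : ℤ × List ℤ × ℕ, linTupleOK 12 e = true ∧ linPrim e = true ∧ linIsTrg e = true ∧ x = lin7TupleVal e := by
  obtain ⟨e, hok, hprim, rfl⟩ := exists_prim_of_mem_linFamily hL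
  obtain ⟨e', hok', hcan', hprim', hv⟩ := exists_canon_prim_of_mem_trgFullFamily hT
  by_cases ht : linIsTrg e = true
  · exact ⟨e, hok, hprim, ht, rfl⟩
  · exfalso
    have hsep := cross_descr_separated hok hprim (by simpa using ht) hok' hcan' hprim' h1 h2 (hv ▸ h1) (hv ▸ h2)
    rw [← hv, sub_self, abs_zero] at hsep
    have hpos : (0 : ℝ) < (dX : ℝ) / distU := div_pos (by unfold dX; norm_num) distU_pos.1
    linarith

/-- All `TRG`-form tuples of the table: `(0, p·e_i, q)`, `i < 7`, `1 ≤ p, q ≤ 12` (1 008 tuples). [folklore] -/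
def linFormAll : List (ℤ × List ℤ × ℕ) :=
  (List.range 7).flatMap fun i => (List.range' 1 12).flatMap fun p : ℕ => (List.range' 1 12).map fun q : ℕ =>
    ((0 : ℤ), List.replicate i 0 ++ (p : ℤ) :: List.replicate (6 - i) 0, q)

/-- Membership in `linFormAll`. [folklore] -/
theorem mem_linFormAll {i p q : ℕ} (hi : i < 7) (hp1 : 1 ≤ p) (hp : p ≤ 12) (hq1 : 1 ≤ q) (hq : q ≤ 12) :
    ((0 : ℤ), List.replicate i 0 ++ (p : ℤ) :: List.replicate (6 - i) 0, q) ∈ linFormAll := by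
  unfold linFormAll
  simp only [List.mem_flatMap, List.mem_range, List.mem_range'_1, List.mem_map]
  exact ⟨i, hi, p, by omega, q, by omega, rfl⟩

/-- **The sixteen.** The `TRG`-form tuples with value in the certified segment: `ζ(5)·{11/9, 5/4, 9/7, 4/3}`,
`ζ(3)·{12/11, 11/10, 10/9, 9/8, 8/7}`, `G·{7/5, 10/7, 3/2}`, `log 2·{11/6, 2}`, `π·{5/12, 3/7}`. [folklore] -/
def linForms16 : List (ℤ × List ℤ × ℕ) :=
  [(0, [0, 0, 0, 0, 0, 11, 0], 9), (0, [0, 0, 0, 0, 0, 5, 0], 4), (0, [0, 0, 0, 0, 0, 9, 0], 7),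
    (0, [0, 0, 0, 0, 0, 4, 0], 3), (0, [0, 0, 0, 0, 12, 0, 0], 11), (0, [0, 0, 0, 0, 11, 0, 0], 10),
    (0, [0, 0, 0, 0, 10, 0, 0], 9), (0, [0, 0, 0, 0, 9, 0, 0], 8), (0, [0, 0, 0, 0, 8, 0, 0], 7),
    (0, [0, 0, 0, 0, 0, 0, 7], 5), (0, [0, 0, 0, 0, 0, 0, 10], 7), (0, [0, 0, 0, 0, 0, 0, 3], 2),
    (0, [0, 0, 0, 11, 0, 0, 0], 6), (0, [0, 0, 0, 2, 0, 0, 0], 1), (0, [5, 0, 0, 0, 0, 0, 0], 12),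
    (0, [3, 0, 0, 0, 0, 0, 0], 7)]

/-- Kernel: every form tuple is decided by the census machine's `linBinOf` (bins `0–2` inside the segment, `3` outside,
never `4`), and the primitive ones binned inside are exactly `linForms16`. [folklore] -/
theorem linFormAll_binned :
    (linFormAll.all fun e => decide (linBinOf e ≤ 3) &&
      (!linPrim e || (decide (linBinOf e ≤ 2) == decide (e ∈ linForms16)))) = true := by
  decide +kernel

/-- Kernel: the sixteen are primitive `TRG`-form tuples of the table, binned inside, pairwise distinct. [folklore] -/
theorem linForms16_ok :
    (linForms16.all fun e => linTupleOK 12 e && linPrim e && linIsTrg e && decide (linBinOf e ≤ 2)) = true ∧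
      linForms16.Nodup := by
  constructor <;> decide +kernel

/-- A tuple binned `≤ 2` has its value in the segment; binned `3`, outside. [folklore] -/
theorem mem_seg_of_bin {e : ℤ × List ℤ × ℕ} (hok : linTupleOK 12 e = true) :
    (linBinOf e ≤ 2 → (81 / 64 : ℝ) ≤ lin7TupleVal e ∧ lin7TupleVal e ≤ 2855 / 2048) ∧
      (linBinOf e = 3 → ¬((81 / 64 : ℝ) ≤ lin7TupleVal e ∧ lin7TupleVal e ≤ 2855 / 2048)) := by
  obtain ⟨a0, c, ax⟩ := e
  obtain ⟨s0, s1, s2, s3⟩ := linBinOf_spec a0 c (linTupleOK_ax_pos hok)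
  have c0 : ((segCutQ 0 : ℚ) : ℝ) = 81 / 64 := by norm_num [segCutQ]
  have c1 : ((segCutQ 1 : ℚ) : ℝ) = 13 / 10 := by norm_num [segCutQ]
  have c2 : ((segCutQ 2 : ℚ) : ℝ) = 27 / 20 := by norm_num [segCutQ]
  have c3 : ((segCutQ 3 : ℚ) : ℝ) = 2855 / 2048 := by norm_num [segCutQ]
  rw [c0, c1] at s0; rw [c1, c2] at s1; rw [c2, c3] at s2; rw [c0, c3] at s3
  constructor
  · intro hb
    rcases Nat.lt_or_ge (linBinOf (a0, c, ax)) 1 with h | h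
    · have := s0 (by omega); exact ⟨this.1, by linarith [this.2]⟩
    rcases Nat.lt_or_ge (linBinOf (a0, c, ax)) 2 with h' | h'
    · have := s1 (by omega); exact ⟨by linarith [this.1], by linarith [this.2]⟩
    · have := s2 (by omega); exact ⟨by linarith [this.1], this.2⟩
  · intro hb hin
    rcases s3 hb with h | h <;> linarith [hin.1, hin.2]

/-- For a primitive `TRG`-form tuple: value in the segment iff it is one of the sixteen. [folklore] -/
theorem form_in_seg_iff {e : ℤ × List ℤ × ℕ} (hok : linTupleOK 12 e = true) (hprim : linPrim e = true)
    (h : linIsTrg e = true) :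
    ((81 / 64 : ℝ) ≤ lin7TupleVal e ∧ lin7TupleVal e ≤ 2855 / 2048) ↔ e ∈ linForms16 := by
  obtain ⟨a0, c, ax⟩ := e
  obtain ⟨rfl, i, p, hi, hp1, hp, rfl⟩ := linIsTrg_shape hok h
  have hok' := hok
  simp only [linTupleOK, Bool.and_eq_true, decide_eq_true_eq] at hok'
  obtain ⟨⟨⟨⟨⟨-, h1⟩, h2⟩, -⟩, -⟩, -⟩ := hok'
  have hmem := mem_linFormAll hi hp1 hp h1 h2
  have hall := List.all_eq_true.mp linFormAll_binned _ hmem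
  simp only [Bool.and_eq_true, Bool.or_eq_true, Bool.not_eq_true', decide_eq_true_eq, beq_iff_eq] at hall
  obtain ⟨hb3, hiff⟩ := hall
  rcases hiff with hnp | hiff
  · rw [hprim] at hnp; exact absurd hnp (by decide)
  rw [decide_eq_decide] at hiff
  obtain ⟨hin, hout⟩ := mem_seg_of_bin hok
  constructor
  · intro hseg
    have hb2 : linBinOf (0, List.replicate i 0 ++ (p : ℤ) :: List.replicate (6 - i) 0, ax) ≤ 2 := by
      by_contra hn
      exact hout (by omega) hseg
    exact hiff.mp hb2
  · intro hm
    exact hin (hiff.mpr hm)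

/-- **The common values of the two tables on the certified segment are exactly the sixteen.** [folklore] -/
theorem lin_inter_trg_segment_eq :
    linFamily 12 ∩ trgFullFamily 17 32 ∩ Set.Icc (81 / 64 : ℝ) (2855 / 2048) =
      lin7TupleVal '' {e | e ∈ linForms16} := by
  obtain ⟨h16, -⟩ := linForms16_ok
  ext x
  constructor
  · rintro ⟨⟨hL, hT⟩, h1, h2⟩
    obtain ⟨e, hok, hprim, ht, rfl⟩ := mem_inter_imp_form hL hT h1 h2
    exact ⟨e, (form_in_seg_iff hok hprim ht).mp ⟨h1, h2⟩, rfl⟩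
  · rintro ⟨e, he, rfl⟩
    have hall := List.all_eq_true.mp h16 e he
    simp only [Bool.and_eq_true, decide_eq_true_eq] at hall
    obtain ⟨⟨⟨hok, hprim⟩, ht⟩, -⟩ := hall
    obtain ⟨e', hok', -, -, hv⟩ := linForm_mem_trgFullFamily hok hprim ht
    have hseg := (form_in_seg_iff hok hprim ht).mpr he
    exact ⟨⟨mem_linFamily_of_linTupleOK hok, hv ▸ mem_trgFullFamily_of_trgGTupleOK hok'⟩, hseg.1, hseg.2⟩

/-- **Exactly sixteen common values on the segment.** [folklore] -/
theorem lin_inter_trg_segment_ncard :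
    (linFamily 12 ∩ trgFullFamily 17 32 ∩ Set.Icc (81 / 64 : ℝ) (2855 / 2048)).ncard = 16 := by
  obtain ⟨h16, hnd⟩ := linForms16_ok
  rw [lin_inter_trg_segment_eq, Set.InjOn.ncard_image]
  · have e : {e : ℤ × List ℤ × ℕ | e ∈ linForms16} = ↑linForms16.toFinset := by ext e; simp
    rw [e, Set.ncard_coe_finset, List.toFinset_card_of_nodup hnd]; rfl
  · refine Set.InjOn.mono (fun e he => ?_) lin_value_injOn
    have hall := List.all_eq_true.mp h16 e he
    simp only [Bool.and_eq_true, decide_eq_true_eq] at hall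
    obtain ⟨⟨⟨hok, hprim⟩, ht⟩, -⟩ := hall
    exact ⟨hok, hprim, (form_in_seg_iff hok hprim ht).mpr he⟩

/-! ### The union of the two tables: count and resolution -/

/-- **The two transcendental tables hold exactly `112660 + 39339 − 16 = 151983` distinct values on the certified
segment.** [folklore] -/
theorem realTables_values_ncard :
    ((linFamily 12 ∪ trgFullFamily 17 32) ∩ Set.Icc (81 / 64 : ℝ) (2855 / 2048)).ncard = 151983 := by
  set S := Set.Icc (81 / 64 : ℝ) (2855 / 2048) with hS
  have hA := lin_values_segment_ncard
  have hB := trg_values_segment_ncard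
  have hI := lin_inter_trg_segment_ncard
  have hAf : (linFamily 12 ∩ S).Finite := Set.finite_of_ncard_ne_zero (by rw [hA]; norm_num)
  have hBf : (trgFullFamily 17 32 ∩ S).Finite := Set.finite_of_ncard_ne_zero (by rw [hB]; norm_num)
  have hu := Set.ncard_union_add_ncard_inter (linFamily 12 ∩ S) (trgFullFamily 17 32 ∩ S) hAf hBf
  have e1 : linFamily 12 ∩ S ∪ trgFullFamily 17 32 ∩ S = (linFamily 12 ∪ trgFullFamily 17 32) ∩ S := by
    rw [Set.union_inter_distrib_right]
  have e2 : linFamily 12 ∩ S ∩ (trgFullFamily 17 32 ∩ S) = linFamily 12 ∩ trgFullFamily 17 32 ∩ S := by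
    ext x; simp only [Set.mem_inter_iff]; tauto
  rw [e1, e2, hA, hB, hI] at hu
  omega

/-- **Resolution of the transcendental catalogue on the segment**: any two distinct values of
`linFamily 12 ∪ trgFullFamily 17 32` in `[81/64, 2855/2048]` differ by at least `dL/distU = 4.3966…·10⁻¹²` (attained by a
`LIN` pair, `lin_min_separation_attained`) — a certified `Δε`-interval narrower than that isolates at most one member of the
two tables. [folklore] -/
theorem realTables_resolution {x y : ℝ} (hx : x ∈ linFamily 12 ∪ trgFullFamily 17 32)
    (hy : y ∈ linFamily 12 ∪ trgFullFamily 17 32) (hx1 : (81 / 64 : ℝ) ≤ x) (hx2 : x ≤ 2855 / 2048)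
    (hy1 : (81 / 64 : ℝ) ≤ y) (hy2 : y ≤ 2855 / 2048) (hne : x ≠ y) : (dL : ℝ) / distU ≤ |x - y| := by
  have hLT : (dL : ℝ) / distU ≤ (dT : ℝ) / distU :=
    div_le_div_of_nonneg_right (by unfold dL dT; norm_num) distU_pos.1.le
  have hLX : (dL : ℝ) / distU ≤ (dX : ℝ) / distU :=
    div_le_div_of_nonneg_right (by unfold dL dX; norm_num) distU_pos.1.le
  -- a LIN value against a TRG value (either it is itself a TRG value, or the cross bound applies)
  have key : ∀ {u v : ℝ}, u ∈ linFamily 12 → v ∈ trgFullFamily 17 32 → (81 / 64 : ℝ) ≤ u → u ≤ 2855 / 2048 →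
      (81 / 64 : ℝ) ≤ v → v ≤ 2855 / 2048 → u ≠ v → (dL : ℝ) / distU ≤ |u - v| := by
    intro u v hu hv hu1 hu2 hv1 hv2 huv
    obtain ⟨e, hok, hprim, rfl⟩ := exists_prim_of_mem_linFamily hu
    by_cases ht : linIsTrg e = true
    · obtain ⟨e', hok', -, -, hval⟩ := linForm_mem_trgFullFamily hok hprim ht
      have hu' : lin7TupleVal e ∈ trgFullFamily 17 32 := hval ▸ mem_trgFullFamily_of_trgGTupleOK hok'
      exact hLT.trans (trg_min_separation hu' hv hu1 hu2 hv1 hv2 huv)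
    · obtain ⟨e', hok', hcan', hprim', rfl⟩ := exists_canon_prim_of_mem_trgFullFamily hv
      exact hLX.trans (cross_descr_separated hok hprim (by simpa using ht) hok' hcan' hprim' hu1 hu2 hv1 hv2)
  rcases hx with hx | hx <;> rcases hy with hy | hy
  · exact lin_min_separation hx hy hx1 hx2 hy1 hy2 hne
  · exact key hx hy hx1 hx2 hy1 hy2 hne
  · rw [abs_sub_comm]; exact key hy hx hy1 hy2 hx1 hx2 hne.symm
  · exact hLT.trans (trg_min_separation hx hy hx1 hx2 hy1 hy2 hne)

end ColumnFaceL11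
end Summit.CriticalPhenomena.Ising3D
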